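/-
Copyright (c) 2026. All rights reserved.
Released under Apache 2.0 license as described in the file LICENSE.
-/
import Summits.Langlands.Langlands.Theorems.SoloInformedDcrisTwist
import Summits.Langlands.Langlands.Theorems.SoloInformedFrobBmaxInjective
import Literature.NumberTheory.PAdicHodge.BmaxPlusTDivisibilityFrobenius
import HarnessLib

/-!
# `B_max(F)^{Γ_F} = K₀` and the crystalline clause for `𝟙` at EVERY place `v ∣ ℓ`, unconditionally (rung Λ14)

Programme `solo-Langlands-informed`, repair of the crystalline clause D2-cris of `Summit.Langlands`.  Rungs Λ5
(`SpecC.forall_galBmax_iff_of_tCriterion`), Λ11 (`SpecC.wittInvariants_of_tCriterion`, its §3) and Λ12 §3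
(`D2Cris.crystallineCompatibleAt_one_of_tCriterion`) made every result of the `𝟙`/Tate-twist ladder at a RAMIFIED
place `v ∣ ℓ` conditional on one binder, Colmez's `t`-divisibility criterion in the strong form

  (TC) `x ∈ A_max`, `θ(φⁿ x) = 0` for all `n` ⟹ `pᵐ x ∈ t · A_max`.

What Colmez actually prints (Ann. of Math. 148 (1998), Lemme III.3.4 — now the Literature theorem
`exists_natCast_mul_frobBmaxPlus_eq_tBmax_mul`) is the WEAK form: under the same hypothesis `p · φ(x) ∈ t · A_max`.
This file shows that the weak form suffices and discharges the binder everywhere: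

* §1 `exists_tBmax_pow_mul_frobBmaxPlus_iterate_of_twisted` — the twisted descent of Λ5 run along Frobenius: a
  `χᵏ`-twisted `a ∈ A_max` has `pᵐ · φᴷ(a) = tᵏ · b` with `b ∈ A_max^{Γ_F}`, for every `K ≥ k`;
* §2 `exists_frobBmax_iterate_mul_pow_eq` — hence for an invariant `y ∈ B_max(F) = A_max[1/t]` some Frobenius
  iterate `φ^{f·k}(y)` is `p`-integral with invariant numerator;
* §3 `wittInvariants` ★★ — **(IW) for EVERY `p`-adic field `F`**: an invariant `y` is `p⁻ᴺ ι(W(ι₀) w)`, `w ∈ W(k_F)`.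
  (pull-back from `φ^{fk}(y)` to `y`: `φ` is INJECTIVE on `B_max(F)`, `D2Cris.frobBmax_injective`, and `φ^f = id` on
  the image of `W(k_F)`, Λ9); whence `forall_galBmax_iff` ★★ (**`B_max(F)^{Γ_F} = K₀`** for every `F`) and Λ11 §1 with
  (IW) supplied (`dim D_cris(𝟙_m) = m·f`, `φ_D^f = 1`, the basis/charpoly statement; `dim_{ℚ_p} B_max(F)^{Γ_F} = f` is then
  Λ11 `finrank_fixedSubalgebra_eq_of_wittInvariants hp hF (wittInvariants hp hF hq) hq`);
* §4 `D2Cris.crystallineCompatibleAt_one` ★★★ — **the summit's clause `CrystallineCompatibleAt ι π 𝟙_n v hv` at EVERY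
  place `v ∣ ℓ` of EVERY number field `K`**, for every `π` with Satake parameter `{1, …, 1}` at `v`, with no
  hypothesis left (Λ12 §3 with (TC) discharged); and `D2Cris.crystallineCompatibleAt_twist_one_tateChar_all` — the same
  for every Tate twist `χ_ℓᵏ · 𝟙_n` against the parameter `{q_v⁻ᵏ, …, q_v⁻ᵏ}` (Λ13 transport).

After this file the D2-cris ladder Λ0–Λ13 has NO named input left for `𝟙` and its Tate twists, at every `v ∣ ℓ`.

References: P. Colmez, Ann. of Math. 148 (1998), Lemme III.3.4, §III.2–III.3; J.-M. Fontaine, Astérisque 223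
(1994), Exp. II §2.3, Exp. III §4.1; K. Buzzard, T. Gee, LMS LNS 414 (2014), Conj. 3.2.2.
-/

noncomputable section

open scoped MatrixGroups TensorProduct ValuativeRel Polynomial NumberField Classical
open WittVector Field IsLocalRing ValuativeRel IsDedekindDomain
open Literature.NumberTheory.GaloisRepresentations Literature.NumberTheory.PAdicHodge
open Literature.NumberTheory.GaloisRepresentations.IsNonarchimedeanLocalField
open Literature.NumberTheory.Automorphic

namespace Summit.Langlands.Langlands.Theorems

namespace SpecC

variable {F : Type} [Field F] [ValuativeRel F] [TopologicalSpace F] [IsNonarchimedeanLocalField F] [CharZero F]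
  {p : ℕ} [Fact p.Prime] [Fact (¬ IsUnit (p : integerC F))] [IsAdicComplete (Ideal.span {(p : integerC F)}) (integerC F)]
  (hp : valuation F p < 1) (hF : Function.Surjective (fontaineTheta (integerC F) p))

/-! ### §1 Twisted descent along Frobenius, from the weak (printed) criterion -/

set_option maxHeartbeats 1600000 in
set_option synthInstance.maxHeartbeats 400000 in
/-- `φᴷ(t) = pᴷ · t` in `A_max` (`φ t = p t`, tree `frobBmaxPlus_tBmax`). [cite: FontaineAsterisque223III, Exp. II §1.5.4] -/
theorem frobBmaxPlus_iterate_tBmax (K : ℕ) :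
    (frobBmaxPlus F p)^[K] (tBmax (F := F) (p := p)) = (p : BmaxPlus F p) ^ K * tBmax := by
  induction K with
  | zero => simp only [Function.iterate_zero, id_eq, pow_zero, one_mul]
  | succ K ih =>
    rw [Function.iterate_succ_apply', ih, map_mul, map_pow, map_natCast, frobBmaxPlus_tBmax, map_natCast, pow_succ]
    ring

set_option maxHeartbeats 1600000 in
set_option synthInstance.maxHeartbeats 400000 in
/-- `Γ_F`-invariants of `A_max` stay invariant under `φᴶ` (`φ` commutes with `Γ_F`, tree `galBmaxPlus_frobBmaxPlus`).
[cite: FontaineAsterisque223III, Exp. II §2.3] -/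
theorem galBmaxPlus_frobBmaxPlus_iterate_of_fixed {b : BmaxPlus F p}
    (hb : ∀ σ : absoluteGaloisGroup F, galBmaxPlus σ b = b) (j : ℕ) (σ : absoluteGaloisGroup F) :
    galBmaxPlus σ ((frobBmaxPlus F p)^[j] b) = (frobBmaxPlus F p)^[j] b := by
  induction j with
  | zero => exact hb σ
  | succ j ih => rw [Function.iterate_succ_apply', galBmaxPlus_frobBmaxPlus, ih]

set_option maxHeartbeats 1600000 in
set_option synthInstance.maxHeartbeats 400000 in
include hp hF in
/-- **Twisted descent along Frobenius** (Λ5 `exists_tBmax_pow_mul_of_twisted` with the printed criterion): a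
`χᵏ`-twisted `a ∈ A_max` satisfies `pᵐ · φᵏ(a) = tᵏ · b` with `b ∈ A_max^{Γ_F}`.  Induction on `k`: `θ(φⁿ a) = 0` for
all `n` (Λ5 `thetaBmaxPlus_frobBmaxPlus_iterate_eq_zero_of_twisted`), so Colmez's Lemme III.3.4 gives
`p · φ(a) = t · a₁`; `φ a` is again `χᵏ`-twisted, so `a₁` is `χᵏ⁻¹`-twisted (`twisted_descend`), and `φᵏ⁻¹` of the
relation feeds the induction hypothesis for `a₁` (`φ(t) = p t`). [cite: Colmez1998Annals, Lemme III.3.4]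
[cite: FontaineAsterisque223III, Exp. III §4.1] -/
theorem exists_tBmax_pow_mul_frobBmaxPlus_iterate_of_twisted {k : ℕ} {a : BmaxPlus F p}
    (h : ∀ σ : absoluteGaloisGroup F, galBmaxPlus σ a = chiAmax F p σ ^ k * a) :
    ∃ (m : ℕ) (b : BmaxPlus F p), (∀ σ : absoluteGaloisGroup F, galBmaxPlus σ b = b) ∧
      (p : BmaxPlus F p) ^ m * (frobBmaxPlus F p)^[k] a = tBmax ^ k * b := by
  induction k generalizing a with
  | zero =>
    refine ⟨0, a, fun σ => ?_, by simp only [pow_zero, one_mul, Function.iterate_zero, id_eq]⟩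
    simpa only [pow_zero, one_mul] using h σ
  | succ k ih =>
    -- Colmez's criterion (weak form): `p · φ a = t · a₁`
    obtain ⟨a₁, hx⟩ := exists_natCast_mul_frobBmaxPlus_eq_tBmax_mul
      (thetaBmaxPlus_frobBmaxPlus_iterate_eq_zero_of_twisted hp hF h k.succ_ne_zero)
    have hx' : (p : BmaxPlus F p) ^ 1 * frobBmaxPlus F p a = tBmax * a₁ := by rw [pow_one]; exact hx
    -- `φ a` is `χᵏ⁺¹`-twisted, so `a₁` is `χᵏ`-twisted
    have h₁ : ∀ σ : absoluteGaloisGroup F, galBmaxPlus σ a₁ = chiAmax F p σ ^ k * a₁ :=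
      twisted_descend hF (galBmaxPlus_frobBmaxPlus_of_twisted h) hx'
    obtain ⟨m, b, hb, hm⟩ := ih h₁
    refine ⟨m + 1, (p : BmaxPlus F p) ^ k * b, fun σ => by rw [map_mul, map_pow, map_natCast, hb σ], ?_⟩
    -- `φᵏ` of `p · φ a = t · a₁`: `p · φᵏ⁺¹ a = pᵏ t · φᵏ a₁`
    have e : (p : BmaxPlus F p) * (frobBmaxPlus F p)^[k + 1] a =
        (p : BmaxPlus F p) ^ k * tBmax * (frobBmaxPlus F p)^[k] a₁ := by
      have e0 := congrArg ((frobBmaxPlus F p)^[k]) hx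
      rw [iterate_map_mul, frobBmaxPlus_iterate_natCast, iterate_map_mul, frobBmaxPlus_iterate_tBmax] at e0
      rw [Function.iterate_succ_apply]
      exact e0
    calc (p : BmaxPlus F p) ^ (m + 1) * (frobBmaxPlus F p)^[k + 1] a
          = (p : BmaxPlus F p) ^ m * ((p : BmaxPlus F p) * (frobBmaxPlus F p)^[k + 1] a) := by rw [pow_succ, mul_assoc]
      _ = (p : BmaxPlus F p) ^ m * ((p : BmaxPlus F p) ^ k * tBmax * (frobBmaxPlus F p)^[k] a₁) := by rw [e]
      _ = (p : BmaxPlus F p) ^ k * tBmax * ((p : BmaxPlus F p) ^ m * (frobBmaxPlus F p)^[k] a₁) := by ring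
      _ = (p : BmaxPlus F p) ^ k * tBmax * (tBmax ^ k * b) := by rw [hm]
      _ = tBmax ^ (k + 1) * ((p : BmaxPlus F p) ^ k * b) := by rw [pow_succ]; ring

set_option maxHeartbeats 1600000 in
set_option synthInstance.maxHeartbeats 400000 in
include hp hF in
/-- The same for every later iterate: `pᵐ · φᴷ(a) = tᵏ · b`, `b ∈ A_max^{Γ_F}`, for all `K ≥ k` (apply `φᴷ⁻ᵏ`; `φ`
preserves invariants and `φ(t) = p t`). [cite: Colmez1998Annals, §III.3] -/
theorem exists_tBmax_pow_mul_frobBmaxPlus_iterate_of_twisted' {k : ℕ} {a : BmaxPlus F p}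
    (h : ∀ σ : absoluteGaloisGroup F, galBmaxPlus σ a = chiAmax F p σ ^ k * a) {K : ℕ} (hK : k ≤ K) :
    ∃ (m : ℕ) (b : BmaxPlus F p), (∀ σ : absoluteGaloisGroup F, galBmaxPlus σ b = b) ∧
      (p : BmaxPlus F p) ^ m * (frobBmaxPlus F p)^[K] a = tBmax ^ k * b := by
  obtain ⟨j, rfl⟩ := Nat.exists_eq_add_of_le hK
  obtain ⟨m, b, hb, hm⟩ := exists_tBmax_pow_mul_frobBmaxPlus_iterate_of_twisted hp hF h
  refine ⟨m, ((p : BmaxPlus F p) ^ j) ^ k * (frobBmaxPlus F p)^[j] b, fun σ => by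
    rw [map_mul, map_pow, map_pow, map_natCast, galBmaxPlus_frobBmaxPlus_iterate_of_fixed hb], ?_⟩
  have e := congrArg ((frobBmaxPlus F p)^[j]) hm
  rw [iterate_map_mul, iterate_map_pow, frobBmaxPlus_iterate_natCast, ← Function.iterate_add_apply,
    iterate_map_mul, iterate_map_pow, frobBmaxPlus_iterate_tBmax] at e
  rw [Nat.add_comm k j, e, mul_pow]
  ring

/-! ### §2 A Frobenius iterate of an invariant of `B_max(F) = A_max[1/t]` is `p`-integral -/

set_option maxHeartbeats 1600000 in
set_option synthInstance.maxHeartbeats 400000 in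
/-- `φᴷ ∘ (A_max → A_max[1/t]) = (A_max → A_max[1/t]) ∘ φᴷ`. [folklore] -/
theorem frobBmax_iterate_algebraMap (K : ℕ) (x : BmaxPlus F p) :
    (D2Cris.frobBmax F p)^[K] (algebraMap (BmaxPlus F p) (D2Cris.Bmax F p) x) =
      algebraMap (BmaxPlus F p) (D2Cris.Bmax F p) ((frobBmaxPlus F p)^[K] x) := by
  induction K with
  | zero => rfl
  | succ K ih => rw [Function.iterate_succ_apply', Function.iterate_succ_apply', ih, D2Cris.frobBmax_algebraMap]

set_option maxHeartbeats 1600000 in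
set_option synthInstance.maxHeartbeats 400000 in
include hp hF in
/-- **A Frobenius iterate of an invariant is `p`-integral with invariant numerator**: for `y ∈ B_max(F)^{Γ_F}` and
`f ≥ 1` there are `k, N` and `b ∈ A_max^{Γ_F}` with `φ^{f·k}(y) · pᴺ = b` in `A_max[1/t]`.  (`y = a/tᵏ` with `a`
`χᵏ`-twisted by Λ5 `twisted_of_forall_galBmax`; §1 at `K = f·k ≥ k`; cancel the unit `tᵏ`.)
[cite: Colmez1998Annals, §III.2–III.3] -/
theorem exists_frobBmax_iterate_mul_pow_eq {y : D2Cris.Bmax F p}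
    (hy : ∀ σ : absoluteGaloisGroup F, D2Cris.galBmax σ y = y) {f : ℕ} (hf : f ≠ 0) :
    ∃ (k N : ℕ) (b : BmaxPlus F p), (∀ σ : absoluteGaloisGroup F, galBmaxPlus σ b = b) ∧
      (D2Cris.frobBmax F p)^[f * k] y * (p : D2Cris.Bmax F p) ^ N =
        algebraMap (BmaxPlus F p) (D2Cris.Bmax F p) b := by
  -- `y = a / tᵏ`
  obtain ⟨k, a, e⟩ : ∃ (k : ℕ) (a : BmaxPlus F p),
      y * algebraMap (BmaxPlus F p) (D2Cris.Bmax F p) tBmax ^ k = algebraMap (BmaxPlus F p) (D2Cris.Bmax F p) a :=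
    ⟨(IsLocalization.Away.sec (tBmax (F := F) (p := p)) y).2, (IsLocalization.Away.sec (tBmax (F := F) (p := p)) y).1,
      by simpa only [map_pow] using IsLocalization.Away.sec_spec (tBmax (F := F) (p := p)) y⟩
  have hK : k ≤ f * k := Nat.le_mul_of_pos_left k (Nat.pos_of_ne_zero hf)
  obtain ⟨m, b, hb, hm⟩ :=
    exists_tBmax_pow_mul_frobBmaxPlus_iterate_of_twisted' hp hF (twisted_of_forall_galBmax hp e hy) hK
  refine ⟨k, f * k * k + m, b, hb, ?_⟩
  -- `φ^{fk}` of `y · tᵏ = a`: `φ^{fk} y · (p^{fk} t)ᵏ = φ^{fk} a`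
  have h1 := congrArg ((D2Cris.frobBmax F p)^[f * k]) e
  rw [iterate_map_mul, iterate_map_pow, frobBmax_iterate_algebraMap, frobBmax_iterate_algebraMap,
    frobBmaxPlus_iterate_tBmax] at h1
  have hT : IsUnit (algebraMap (BmaxPlus F p) (D2Cris.Bmax F p) tBmax ^ k) :=
    (D2Cris.isUnit_algebraMap_tBmax (F := F) (p := p)).pow k
  refine hT.mul_left_inj.1 ?_
  calc (D2Cris.frobBmax F p)^[f * k] y * (p : D2Cris.Bmax F p) ^ (f * k * k + m) *
          algebraMap (BmaxPlus F p) (D2Cris.Bmax F p) tBmax ^ k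
        = (D2Cris.frobBmax F p)^[f * k] y *
            algebraMap (BmaxPlus F p) (D2Cris.Bmax F p) ((p : BmaxPlus F p) ^ (f * k) * tBmax) ^ k *
              (p : D2Cris.Bmax F p) ^ m := by
          simp only [map_mul, map_pow, map_natCast]
          ring
    _ = algebraMap (BmaxPlus F p) (D2Cris.Bmax F p) ((frobBmaxPlus F p)^[f * k] a) * (p : D2Cris.Bmax F p) ^ m := by
          rw [h1]
    _ = algebraMap (BmaxPlus F p) (D2Cris.Bmax F p) ((p : BmaxPlus F p) ^ m * (frobBmaxPlus F p)^[f * k] a) := by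
          rw [map_mul, map_pow, map_natCast, mul_comm]
    _ = algebraMap (BmaxPlus F p) (D2Cris.Bmax F p) (tBmax ^ k * b) := by rw [hm]
    _ = algebraMap (BmaxPlus F p) (D2Cris.Bmax F p) b * algebraMap (BmaxPlus F p) (D2Cris.Bmax F p) tBmax ^ k := by
          rw [map_mul, map_pow, mul_comm]

/-! ### §3 (IW) and `B_max(F)^{Γ_F} = K₀` for every `p`-adic field `F` -/

section Main

variable [Fact (¬ IsUnit (p : maxUnramifiedCompletion F))] [CharP (ResidueField (maxUnramifiedCompletion F)) p]

set_option maxHeartbeats 1600000 in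
set_option synthInstance.maxHeartbeats 400000 in
include hp hF in
/-- ★★ **(IW) for EVERY `p`-adic field `F`** (`q_F = p^f`): every `Γ_F`-invariant `y` of the constructed
`B_max(F) = A_max[1/t]` is `p⁻ᴺ ι(W(ι₀) w)` with `w ∈ W(k_F)` — the hypothesis `hW` of Λ11 §1, previously known for
absolutely unramified `F` (Λ7) or under (TC) (Λ11 `wittInvariants_of_tCriterion`).  Proof: `φ^{fk}(y) · pᴺ = b ∈ A_max^{Γ_F}`
(§2), `b = ι(z)` with `z ∈ W(k̄)^{Γ_F} = W(k_F)` (Λ2, Λ7), the element `ι(z)` is fixed by `φ^f` (Λ9), and `φ^{fk}` is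
injective on `B_max(F)` (`D2Cris.frobBmax_injective`), so `y · pᴺ = ι(z)` already. [cite: Colmez1998Annals, §III.2–III.3]
[cite: FontaineAsterisque223III, Exp. III §4.1] -/
theorem wittInvariants {f : ℕ} (hq : residueFieldCard F = p ^ f) :
    ∀ y : D2Cris.Bmax F p, (∀ σ : absoluteGaloisGroup F, D2Cris.galBmax σ y = y) →
      ∃ (n : ℕ) (w : WittVector p 𝓀[F]),
        y * (p : D2Cris.Bmax F p) ^ n =
          algebraMap (BmaxPlus F p) (D2Cris.Bmax F p)
            (ainfToBmaxPlus F p (wittToAinf F p (WittVector.map (D2Cris.resBarField F) w))) := by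
  intro y hy
  haveI : CharP (ResidueField (integerC F)) p := charP_residueField_integerC
  have hf : f ≠ 0 := by
    rintro rfl
    rw [pow_zero] at hq
    exact (one_lt_residueFieldCard F).ne' hq
  obtain ⟨k, N, b, hb, hY⟩ := exists_frobBmax_iterate_mul_pow_eq hp hF hy hf
  obtain ⟨z, hz, rfl⟩ := exists_eq_wittToAinf_of_forall_galBmaxPlus hp hb
  obtain ⟨w, rfl⟩ := (D2Cris.forall_map_residueGal_eq_iff z).1 hz
  refine ⟨N, w, (D2Cris.frobBmax_injective hF).iterate (f * k) ?_⟩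
  have hper : (D2Cris.frobBmax F p)^[f * k]
      (algebraMap (BmaxPlus F p) (D2Cris.Bmax F p)
        (ainfToBmaxPlus F p (wittToAinf F p (WittVector.map (D2Cris.resBarField F) w)))) =
      algebraMap (BmaxPlus F p) (D2Cris.Bmax F p)
        (ainfToBmaxPlus F p (wittToAinf F p (WittVector.map (D2Cris.resBarField F) w))) := by
    rw [Function.iterate_mul]
    exact Function.iterate_fixed
      (by rw [frobBmax_iterate_algebraMap_wittToAinf, iterate_frobenius_map_resBarField hq]) k
  rw [frobBmax_iterate_mul_natCast_pow, hY, hper]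

set_option maxHeartbeats 1600000 in
set_option synthInstance.maxHeartbeats 400000 in
include hp hF in
/-- ★★ **`B_max(F)^{Γ_F} = K₀` for EVERY `p`-adic field `F`**: an element `y` of the constructed `B_max(F) = A_max[1/t]`
is `Γ_F`-invariant iff `y · pⁿ = ι z` for some `n` and some `Γ_F`-invariant unramified Witt vector `z ∈ W(k̄)^{Γ_F} = W(k_F)`,
i.e. iff `y ∈ K₀ = W(k_F)[1/p]` — Λ5 `forall_galBmax_iff_of_tCriterion` with (TC) discharged by Colmez's printed
Lemme III.3.4.  This is the comparison (I2) of the D2-cris repair, now a theorem. [cite: Colmez1998Annals, §III.2–III.3]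
[cite: FontaineAsterisque223III, Exp. III §4.1] -/
theorem forall_galBmax_iff {f : ℕ} (hq : residueFieldCard F = p ^ f) (y : D2Cris.Bmax F p) :
    (∀ σ : absoluteGaloisGroup F, D2Cris.galBmax σ y = y) ↔
      ∃ (n : ℕ) (z : WittVector p (ResidueField (maxUnramifiedCompletion F))),
        (∀ σ : absoluteGaloisGroup F, WittVector.map (residueGal σ) z = z) ∧
          y * (p : D2Cris.Bmax F p) ^ n =
            algebraMap (BmaxPlus F p) (D2Cris.Bmax F p) (ainfToBmaxPlus F p (wittToAinf F p z)) := by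
  haveI : CharP (ResidueField (integerC F)) p := charP_residueField_integerC
  constructor
  · intro hy
    obtain ⟨n, w, h⟩ := wittInvariants hp hF hq y hy
    exact ⟨n, _, (D2Cris.forall_map_residueGal_eq_iff _).2 ⟨w, rfl⟩, h⟩
  · rintro ⟨n, z, hz, hx⟩
    exact (forall_galBmax_iff_of_isPIntegral hp ⟨n, _, hx⟩).2 ⟨n, z, hz, hx⟩

set_option maxHeartbeats 1600000 in
set_option synthInstance.maxHeartbeats 400000 in
include hp hF in
/-- ★ **`dim_{ℚ̄_p} D_cris(𝟙_m) = m · f` for every `p`-adic field `F`** (Λ11 §1 with (IW) supplied).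
[cite: BuzzardGeeLMS2014, Conj. 3.2.2] [cite: FontaineAsterisque223III, Exp. III §1.5] -/
theorem finrank_Dcris_one_eq_mul {f : ℕ} (hq : residueFieldCard F = p ^ f) {m : ℕ} :
    Module.finrank (PadicAlgCl p)
        (D2Cris.Dcris (F := F) (p := p) (1 : FramedRep (absoluteGaloisGroup F) (PadicAlgCl p) m)) = m * f :=
  finrank_Dcris_one_eq_of_wittInvariants hp hF (wittInvariants hp hF hq) hq

set_option maxHeartbeats 1600000 in
set_option synthInstance.maxHeartbeats 400000 in
include hp hF in
/-- ★ **`φ_D^f = 1` on `D_cris(𝟙_m)` for every `p`-adic field `F`** (Λ11 §1 with (IW) supplied).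
[cite: FontaineAsterisque223VIII, §2.3.7] -/
theorem phiDcris_one_pow_eq_one {f : ℕ} (hq : residueFieldCard F = p ^ f) {m : ℕ} :
    D2Cris.phiDcris (F := F) (p := p) (1 : FramedRep (absoluteGaloisGroup F) (PadicAlgCl p) m) ^ f = 1 :=
  phiDcris_pow_eq_one_of_wittInvariants (wittInvariants hp hF hq) hq

set_option maxHeartbeats 1600000 in
set_option synthInstance.maxHeartbeats 400000 in
include hp hF in
/-- ★★ **The `𝟙_m` instance of the conclusion of `CrystallineCompatibleAt` for every `p`-adic field `F`**, no binder
left: a `ℚ̄_p`-basis of `D_cris(𝟙_m)` indexed by `Fin (m · f)` with `charpoly (φ_D ^ f) = geomFrobPolyOfSatake ι {1,…,1} ^ f`.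
[cite: BuzzardGeeLMS2014, Conj. 3.2.2] [cite: Colmez1998Annals, §III.2–III.3] -/
theorem exists_basis_charpoly_eq_geomFrobPolyOfSatake_pow {f : ℕ} (hq : residueFieldCard F = p ^ f) {m : ℕ}
    (ι : PadicAlgCl p ≃+* ℂ) :
    ∃ b : Module.Basis (Fin (m * f)) (PadicAlgCl p)
        (D2Cris.Dcris (F := F) (p := p) (1 : FramedRep (absoluteGaloisGroup F) (PadicAlgCl p) m)),
      (LinearMap.toMatrix b b (D2Cris.phiDcris (1 : FramedRep (absoluteGaloisGroup F) (PadicAlgCl p) m) ^ f)).charpoly =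
        D2Cris.geomFrobPolyOfSatake ι (Multiset.replicate m 1) ^ f :=
  exists_basis_charpoly_eq_geomFrobPolyOfSatake_pow_of_wittInvariants hp hF (wittInvariants hp hF hq) hq ι

end Main

set_option maxHeartbeats 1600000 in
set_option synthInstance.maxHeartbeats 400000 in
include hp in
/-- ★★ **Input-free form** (`valuation F p < 1` is the only hypothesis; `θ_F` onto and the instance facts of `F̂^nr`
follow from it, as in Λ11 §4): the basis of `D_cris(𝟙_m)` with `charpoly (φ_D ^ f) = geomFrobPolyOfSatake ι {1,…,1} ^ f`.
[cite: BuzzardGeeLMS2014, Conj. 3.2.2] [cite: Colmez1998Annals, §III.2–III.3] -/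
theorem exists_basis_charpoly_eq_geomFrobPolyOfSatake_pow' {f : ℕ} (hq : residueFieldCard F = p ^ f) {m : ℕ}
    (ι : PadicAlgCl p ≃+* ℂ) :
    ∃ b : Module.Basis (Fin (m * f)) (PadicAlgCl p)
        (D2Cris.Dcris (F := F) (p := p) (1 : FramedRep (absoluteGaloisGroup F) (PadicAlgCl p) m)),
      (LinearMap.toMatrix b b (D2Cris.phiDcris (1 : FramedRep (absoluteGaloisGroup F) (PadicAlgCl p) m) ^ f)).charpoly =
        D2Cris.geomFrobPolyOfSatake ι (Multiset.replicate m 1) ^ f := by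
  haveI : Fact (¬ IsUnit (p : maxUnramifiedCompletion F)) := ⟨not_isUnit_natCast_completion hp⟩
  haveI : CharP (IsLocalRing.ResidueField (maxUnramifiedCompletion F)) p := charP_residueField_completion
  exact exists_basis_charpoly_eq_geomFrobPolyOfSatake_pow hp (surjective_fontaineTheta_integerC hp) hq ι

end SpecC

/-! ### §4 The clause `CrystallineCompatibleAt ι π 𝟙_n v hv` at EVERY place `v ∣ ℓ`, and its Tate twists -/

namespace D2Cris

variable {n : ℕ} {K : Type} [Field K] [NumberField K] {hcpt : isCompact_glFiniteIntegralLevel n K}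
  {ℓ : ℕ} [Fact ℓ.Prime]

/-- ★★ **The conclusion of `CrystallineCompatibleAt` for the trivial global representation at EVERY place `v ∣ ℓ`**
(ramified or not; Λ12 `exists_basis_charpoly_phiDcris_toLocal_one` needed `e(v|ℓ) = 1`, Λ12 §3 needed (TC)): a
`ℚ̄_ℓ`-basis of `D_cris(𝟙_n|Γ_{K_v})` indexed by `Fin (n · f(v|ℓ))` with
`charpoly (φ_D ^ f(v|ℓ)) = geomFrobPolyOfSatake ι {1, …, 1} ^ f(v|ℓ)`. [cite: BuzzardGeeLMS2014, Conj. 3.2.2]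
[cite: Colmez1998Annals, Lemme III.3.4] -/
theorem exists_basis_charpoly_phiDcris_toLocal_one_all (ι : PadicAlgCl ℓ ≃+* ℂ) (v : HeightOneSpectrum (𝓞 K))
    (hv : ((ℓ : ℕ) : 𝓞 K) ∈ v.asIdeal) [CharZero (v.adicCompletion K)]
    [Fact (¬ IsUnit ((ℓ : ℕ) : integerC (v.adicCompletion K)))]
    [IsAdicComplete (Ideal.span {((ℓ : ℕ) : integerC (v.adicCompletion K))}) (integerC (v.adicCompletion K))] :
    ∃ b : Module.Basis (Fin (n * v.asIdeal.inertiaDeg ℤ)) (PadicAlgCl ℓ)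
        (Dcris (p := ℓ) ((1 : FramedGaloisRep K (PadicAlgCl ℓ) n).toLocal v)),
      (LinearMap.toMatrix b b
          (phiDcris (p := ℓ) ((1 : FramedGaloisRep K (PadicAlgCl ℓ) n).toLocal v) ^ v.asIdeal.inertiaDeg ℤ)).charpoly =
        geomFrobPolyOfSatake ι (Multiset.replicate n 1) ^ v.asIdeal.inertiaDeg ℤ := by
  rw [toLocal_one]
  exact SpecC.exists_basis_charpoly_eq_geomFrobPolyOfSatake_pow'
    (LocalField.valuation_adicCompletion_natCast_lt_one v ℓ hv) (residueFieldCard_adicCompletion_eq_pow_inertiaDeg v hv) ι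

/-- ★★★ **`CrystallineCompatibleAt ι π 𝟙_n v hv` at EVERY place `v ∣ ℓ` of EVERY number field `K`**, for every `π`
whose Satake parameter at `v` is `{1, …, 1}` — the summit's clause as typed, no hypothesis left (the instance facts of
`K_v` are installed from `hv` by the clause's own terms). [cite: BuzzardGeeLMS2014, Conj. 3.2.2]
[cite: Colmez1998Annals, Lemme III.3.4] -/
theorem crystallineCompatibleAt_one (ι : PadicAlgCl ℓ ≃+* ℂ) (π : AutomorphicRepData (AutomorphyDatum.gl n K hcpt))
    (v : HeightOneSpectrum (𝓞 K)) (hv : ((ℓ : ℕ) : 𝓞 K) ∈ v.asIdeal)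
    (hπ : ∀ α : Multiset ℂ, π.HasSatakeParamAt v α → α = Multiset.replicate n 1) :
    CrystallineCompatibleAt ι π (1 : FramedGaloisRep K (PadicAlgCl ℓ) n) v hv := by
  unfold CrystallineCompatibleAt
  intro α hα
  obtain rfl := hπ α hα
  haveI := LocalField.charZero_adicCompletion v
  have hp := LocalField.valuation_adicCompletion_natCast_lt_one v ℓ hv
  haveI : Fact (¬ IsUnit ((ℓ : ℕ) : integerC (v.adicCompletion K))) := ⟨not_isUnit_natCast_integerC hp⟩
  haveI : IsAdicComplete (Ideal.span {((ℓ : ℕ) : integerC (v.adicCompletion K))})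
      (integerC (v.adicCompletion K)) := isAdicComplete_integerC_natCast hp
  exact exists_basis_charpoly_phiDcris_toLocal_one_all ι v hv

/-- **All places above `ℓ` at once** (the `v ∣ ℓ` half of `CorrespondsD2Cris` for `𝟙_n`). [cite: BuzzardGeeLMS2014, Conj. 3.2.2] -/
theorem forall_crystallineCompatibleAt_one (ι : PadicAlgCl ℓ ≃+* ℂ) (π : AutomorphicRepData (AutomorphyDatum.gl n K hcpt))
    (hπ : ∀ v : HeightOneSpectrum (𝓞 K), ((ℓ : ℕ) : 𝓞 K) ∈ v.asIdeal →
      ∀ α : Multiset ℂ, π.HasSatakeParamAt v α → α = Multiset.replicate n 1) :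
    ∀ (v : HeightOneSpectrum (𝓞 K)) (hv : ((ℓ : ℕ) : 𝓞 K) ∈ v.asIdeal),
      CrystallineCompatibleAt ι π (1 : FramedGaloisRep K (PadicAlgCl ℓ) n) v hv :=
  fun v hv => crystallineCompatibleAt_one ι π v hv (hπ v hv)

/-- ★★ **Every Tate twist `χ_ℓᵏ · 𝟙_n` satisfies the clause at EVERY place `v ∣ ℓ`**, against every `π` with Satake
parameter `{q_v⁻ᵏ, …, q_v⁻ᵏ}` at `v` (Λ13 `exists_basis_charpoly_phiDcris_of_eq_twist` transporting the untwisted basis).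
[cite: BuzzardGeeLMS2014, Conj. 3.2.2] [cite: FontaineAsterisque223VIII, §2.3.7] -/
theorem crystallineCompatibleAt_twist_one_tateChar_all (ι : PadicAlgCl ℓ ≃+* ℂ)
    (π : AutomorphicRepData (AutomorphyDatum.gl n K hcpt)) (v : HeightOneSpectrum (𝓞 K)) (hv : ((ℓ : ℕ) : 𝓞 K) ∈ v.asIdeal)
    (k : ℕ) (hπ : π.HasSatakeParamAt v (Multiset.replicate n (((ℓ : ℂ) ^ (k * v.asIdeal.inertiaDeg ℤ))⁻¹))) :
    CrystallineCompatibleAt ι π (FramedRep.twist (1 : FramedGaloisRep K (PadicAlgCl ℓ) n) (tateChar K ℓ k)) v hv := by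
  unfold CrystallineCompatibleAt
  intro β hβ
  obtain rfl := AutomorphicRepData.hasSatakeParamAt_unique_holds π hβ hπ
  haveI := LocalField.charZero_adicCompletion v
  have hp := LocalField.valuation_adicCompletion_natCast_lt_one v ℓ hv
  haveI : Fact (¬ IsUnit ((ℓ : ℕ) : integerC (v.adicCompletion K))) := ⟨not_isUnit_natCast_integerC hp⟩
  haveI : IsAdicComplete (Ideal.span {((ℓ : ℕ) : integerC (v.adicCompletion K))})
      (integerC (v.adicCompletion K)) := isAdicComplete_integerC_natCast hp
  have h := exists_basis_charpoly_phiDcris_of_eq_twist ((1 : FramedGaloisRep K (PadicAlgCl ℓ) n).toLocal v) _ k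
    (toLocal_twist_tateChar (1 : FramedGaloisRep K (PadicAlgCl ℓ) n) k v) ι
    (exists_basis_charpoly_phiDcris_toLocal_one_all ι v hv)
  rwa [Multiset.map_replicate, mul_one] at h

end D2Cris

end Summit.Langlands.Langlands.Theorems

end
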